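import Literature.NumberTheory.LFunctions.SuzukiCanonicalSystemKernelProofs
import HarnessLib

/-!
# Small windows carry no unit eigenvalue: [Su21] Thm. 2.1 (second half) = Prop. 4.2 and [Su20] Thm. 1.2 (K-v), PROVED

Companion ("de-factification") file of `SuzukiCanonicalSystem.lean` (M. Suzuki, *Hamiltonians arising
from L-functions in the Selberg class*, J. Funct. Anal. **281** (2021) 109116 = arXiv:1606.05726
[Suzuki2021Hamiltonians]) and of `SuzukiSingleOperatorKernel.lean` (M. Suzuki, *Integral operators
arising from the Riemann zeta function*, Adv. Stud. Pure Math. **84** (2020) 399–411 = arXiv:1907.07302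
[Suzuki2020IntegralOperators]). RH-FREE throughout; nothing here bears on the truth of RH.

## What is proved

* `Suzuki2021_thm21_holds : Suzuki2021_thm21` — **the named fact [Su21] Thm. 2.1 (second half) =
  Prop. 4.2 for `L = ζ` is DISCHARGED**: for `ω > 0`, `ν ≥ 1`, `νω > 1` ((2.8)) there is `τ > 0` such
  that `±1` are not eigenvalues of `f ↦ ∫_{(−t,t)} K_ζ^{ω,ν}(· + y) f(y) dy` on `L²(−t,t)` for every
  `0 ≤ t < τ` (`NoUnitEigenvalue (suzukiKernel ω ν) t`), i.e. (K5) holds on `[0,τ)` and the Hamiltonian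
  `H_ζ^{ω,ν}` is defined near `t = 0` unconditionally. [cite: Suzuki2021Hamiltonians, Thm. 2.1, Prop. 4.2]
* `Suzuki2020_thm12_Kv` — **[Su20] Thm. 1.2 (K-v) for every `θ > 1`** (the last clause of the named fact
  `Suzuki2020_thm12`; partial discharge, next to `Suzuki2020_thm12_Kiii`, `Suzuki2020_thm12_continuous`,
  `Suzuki2020_thm12_fourier` of `SuzukiSingleOperatorKernelProofs.lean`): there is `τ > 0` with
  `NoUnitEigenvalue (limKernel θ) t` for `0 ≤ t < τ`. [cite: Suzuki2020IntegralOperators, Thm. 1.2 (K-v)]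

## The proof, and where it deviates from the printed one

Printed proof of Prop. 4.2 [Suzuki2021Hamiltonians, §4.2, pp. 20–21 of the arXiv text]: an eigenfunction
`P_t 𝖪 f = ±f`, `0 ≠ f ∈ L²(−∞,t)`, is supported in `[−t,t]`; on the Fourier side
`(F g_{−v})(u) = Θ(u+iv)(F f_v)(−u)` (Lemma 3.2) gives `‖g_{−v}‖ ≤ M_v e^{vt}‖f‖` with
`M_v = max_u |Θ(u+iv)|`, while the eigen-equation gives `e^{vt}‖P_t g_{−v}‖ ≥ ‖f‖`; by (4.3)
`M_v² e^{4vt} ≪ exp(4vt − 2νω d_L log v) < 1` for `t` small relative to a fixed `v > ½ + ω` — a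
contradiction. No value of `τ` is printed.

Here (a genuinely shorter road, `ζ`-free and K-general, using only what the tree has already proved
about the kernels): the **small-window test** `noUnitEigenvalue_of_small_window` — if `|K(u)| ≤ M` for
`|u| < 2t` and `2tM < 1`, then `𝖪[t]` has no eigenvalue `±1` on `L²(−t,t)`. Indeed an eigenfunction
satisfies, for a.e. `|x| < t`, `|f(x)| = |∫_{(−t,t)} K(x+y) f(y) dy| ≤ M ‖f‖_{L¹(−t,t)}` (`|x+y| < 2t`);
integrating over `(−t,t)`: `‖f‖₁ ≤ 2tM ‖f‖₁`, so `‖f‖₁ = 0` and `f = 0` a.e. (`L²(−t,t) ⊂ L¹(−t,t)`).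
A continuous kernel is bounded on `[−1,1]`, whence `exists_noUnitEigenvalue_of_continuous`: every
continuous `K` has unit-eigenvalue-free windows `[0,τ)`, `τ = min(½, 1/(2(C+1)))` with `C` a bound for
`|K|` on `[−1,1]`. The continuity inputs are the tree theorems `suzuki2021_prop41_iv` ([Su21]
Prop. 4.1 (4), spectral kernel, `νω > 1`) and `Suzuki2020_thm12_continuous` ([Su20] Thm. 1.2 (K-ii),
`θ > 1`). This is the same mechanism as the printed proof (the operator is small for small `t`), run in
`L¹` on the kernel side instead of `L²` on the symbol side; it needs neither Lemma 3.2 nor (4.3).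

## References

* [Suzuki2021Hamiltonians] M. Suzuki, J. Funct. Anal. 281 (2021) 109116, arXiv:1606.05726: Thm. 2.1,
  Prop. 4.2 (§4.2), (2.8), (2.9).
* [Suzuki2020IntegralOperators] M. Suzuki, Adv. Stud. Pure Math. 84 (2020) 399–411, arXiv:1907.07302:
  Thm. 1.2 (K-v).
-/

noncomputable section

open MeasureTheory Set

namespace Literature.NumberTheory.LFunctions

/-! ## A `ζ`-free small-window test for kernels `K(x + y)` on `L²(−t,t)` (K-general) -/

/-- Pointwise bound for the compressed operator: if `|K(u)| ≤ M` for `|u| < 2t` and `f` is integrable on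
`(−t,t)`, then for `|x| < t`, `|∫_{(−t,t)} K(x+y) f(y) dy| ≤ M ∫_{(−t,t)} |f|` (the kernel-side form of
the operator bound in the proof of [Su21] Prop. 4.2). [cite: Suzuki2021Hamiltonians, Prop. 4.2 (proof, §4.2)] -/
theorem abs_setIntegral_window_le {K : ℝ → ℝ} {t M : ℝ} (hK : ∀ u : ℝ, |u| < 2 * t → |K u| ≤ M)
    {f : ℝ → ℝ} (hf : Integrable f (volume.restrict (Ioo (-t) t))) {x : ℝ} (hx : x ∈ Ioo (-t) t) :
    |∫ y in Ioo (-t) t, K (x + y) * f y| ≤ M * ∫ y in Ioo (-t) t, |f y| := by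
  have hbound : ∀ᵐ y ∂(volume.restrict (Ioo (-t) t)), ‖K (x + y) * f y‖ ≤ M * |f y| := by
    filter_upwards [ae_restrict_mem measurableSet_Ioo] with y hy
    rw [Real.norm_eq_abs, abs_mul]
    have hxy : |x + y| < 2 * t := by
      rw [abs_lt]
      constructor <;> linarith [hx.1, hx.2, hy.1, hy.2]
    exact mul_le_mul_of_nonneg_right (hK _ hxy) (abs_nonneg _)
  have hg : Integrable (fun y => M * |f y|) (volume.restrict (Ioo (-t) t)) := hf.abs.const_mul M
  calc |∫ y in Ioo (-t) t, K (x + y) * f y| = ‖∫ y in Ioo (-t) t, K (x + y) * f y‖ :=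
        (Real.norm_eq_abs _).symm
    _ ≤ ∫ y in Ioo (-t) t, M * |f y| := norm_integral_le_of_norm_le hg hbound
    _ = M * ∫ y in Ioo (-t) t, |f y| := integral_const_mul _ _

/-- **Small-window test** (RH-free, `ζ`-free, K-general): if `|K(u)| ≤ M` for `|u| < 2t` and `2tM < 1`,
then `±1` are not eigenvalues of `f ↦ ∫_{(−t,t)} K(· + y) f(y) dy` on `L²(−t,t)` (`NoUnitEigenvalue K t`).
Proof: an eigenfunction satisfies `|f(x)| ≤ M‖f‖_{L¹(−t,t)}` for a.e. `|x| < t`; integrating,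
`‖f‖₁ ≤ 2tM‖f‖₁`, so `‖f‖₁ = 0`. (For `t ≤ 0` the window is empty.) This is the mechanism of the printed
proof of [Su21] Prop. 4.2 («`𝖪[t]` is small for small `t`»), run on the kernel side.
[cite: Suzuki2021Hamiltonians, Prop. 4.2 (proof, §4.2)] -/
theorem noUnitEigenvalue_of_small_window {K : ℝ → ℝ} {t M : ℝ}
    (hK : ∀ u : ℝ, |u| < 2 * t → |K u| ≤ M) (htM : 2 * t * M < 1) : NoUnitEigenvalue K t := by
  intro ε hε f hf heig
  rcases le_or_gt t 0 with ht | ht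
  · -- the window `(−t,t)` is empty
    have he : Ioo (-t) t = ∅ := Ioo_eq_empty (by linarith)
    rw [Filter.EventuallyEq, ae_iff, he, Measure.restrict_empty]
    rfl
  · have hfi : Integrable f (volume.restrict (Ioo (-t) t)) := hf.integrable one_le_two
    have hfa : Integrable (fun y => |f y|) (volume.restrict (Ioo (-t) t)) := hfi.abs
    set A : ℝ := ∫ y in Ioo (-t) t, |f y| with hAdef
    have hA0 : 0 ≤ A := integral_nonneg fun y => abs_nonneg _
    -- pointwise: `|f x| ≤ M A` for a.e. `x` in the window
    have hpt : ∀ᵐ x ∂(volume.restrict (Ioo (-t) t)), |f x| ≤ M * A := by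
      filter_upwards [heig, ae_restrict_mem measurableSet_Ioo] with x hx hxmem
      have h1 : |f x| = |∫ y in Ioo (-t) t, K (x + y) * f y| := by
        rw [hx, abs_mul]
        rcases hε with rfl | rfl <;> simp
      rw [h1]
      exact abs_setIntegral_window_le hK hfi hxmem
    -- integrate over the window (length `2t`)
    have hle : A ≤ 2 * t * M * A := by
      have h := integral_mono_ae hfa (integrable_const (M * A)) hpt
      rw [setIntegral_const, Real.volume_real_Ioo_of_le (by linarith), smul_eq_mul] at h
      calc A ≤ (t - -t) * (M * A) := h
        _ = 2 * t * M * A := by ring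
    have hA : A = 0 := by
      refine le_antisymm ?_ hA0
      nlinarith [hA0, hle, htM]
    have hae : (fun y => |f y|) =ᵐ[volume.restrict (Ioo (-t) t)] 0 :=
      (integral_eq_zero_iff_of_nonneg_ae (Filter.Eventually.of_forall fun y => abs_nonneg (f y))
        hfa).1 hA
    filter_upwards [hae] with y hy
    simpa using hy

/-- **Every continuous kernel has unit-eigenvalue-free small windows** (RH-free, `ζ`-free, K-general):
if `K` is continuous then there is `τ > 0` (explicitly `τ = min(½, 1/(2(|C|+1)))` for any bound `C` of
`|K|` on `[−1,1]`) with `NoUnitEigenvalue K t` for all `0 ≤ t < τ`.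
[cite: Suzuki2021Hamiltonians, Prop. 4.2 (proof, §4.2)] -/
theorem exists_noUnitEigenvalue_of_continuous {K : ℝ → ℝ} (hK : Continuous K) :
    ∃ τ : ℝ, 0 < τ ∧ ∀ t : ℝ, 0 ≤ t → t < τ → NoUnitEigenvalue K t := by
  obtain ⟨C, hC⟩ :=
    (isCompact_Icc : IsCompact (Icc (-1 : ℝ) 1)).exists_bound_of_continuousOn hK.continuousOn
  have hpos : 0 < |C| + 1 := by positivity
  refine ⟨min (1 / 2) (1 / (2 * (|C| + 1))), lt_min (by norm_num) (by positivity),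
    fun t _ht0 htτ => ?_⟩
  have ht1 : t < 1 / 2 := lt_of_lt_of_le htτ (min_le_left _ _)
  have ht2 : t < 1 / (2 * (|C| + 1)) := lt_of_lt_of_le htτ (min_le_right _ _)
  refine noUnitEigenvalue_of_small_window (M := |C| + 1) (fun u hu => ?_) ?_
  · have hu1 : u ∈ Icc (-1 : ℝ) 1 := by
      rw [abs_lt] at hu
      constructor <;> linarith
    have h := hC u hu1
    rw [Real.norm_eq_abs] at h
    linarith [le_abs_self C]
  · have h : t * (2 * (|C| + 1)) < 1 := by rwa [lt_div_iff₀ (by positivity)] at ht2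
    calc 2 * t * (|C| + 1) = t * (2 * (|C| + 1)) := by ring
      _ < 1 := h

/-! ## The discharges -/

/-- **[Su21] Thm. 2.1 (second half) = Prop. 4.2 for `L = ζ`, PROVED — discharge of the named fact
`Suzuki2021_thm21`**: for `ω > 0`, `ν ≥ 1`, `νω > 1` there is `τ > 0` such that `±1` are not
eigenvalues of `𝖪_ζ^{ω,ν}[t]` (on `L²(−t,t)`) for every `0 ≤ t < τ`. From the continuity of the
spectral kernel under (2.8) ([Su21] Prop. 4.1 (4), tree theorem `suzuki2021_prop41_iv`) and the
small-window test. RH-FREE. [cite: Suzuki2021Hamiltonians, Thm. 2.1 and Prop. 4.2] -/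
theorem Suzuki2021_thm21_holds : Suzuki2021_thm21 := fun _ω hω ν _hν hνω =>
  exists_noUnitEigenvalue_of_continuous (suzuki2021_prop41_iv hω ν hνω)

/-- **[Su20] Thm. 1.2 (K-v), PROVED for every `θ > 1`** (the last clause of the named fact
`Suzuki2020_thm12`): «there exists `τ₁ > 0` such that both `±1` are not eigenvalues of `K_θ[τ]` for
every `0 ≤ τ < τ₁`», here for the block on `L²(−t,t)` (`NoUnitEigenvalue (limKernel θ) t`). From the
continuity of `K_θ` (tree theorem `Suzuki2020_thm12_continuous`, (K-ii)) and the small-window test.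
RH-FREE. [cite: Suzuki2020IntegralOperators, Thm. 1.2 (K-v)] -/
theorem Suzuki2020_thm12_Kv {θ : ℝ} (hθ : 1 < θ) :
    ∃ τ : ℝ, 0 < τ ∧ ∀ t : ℝ, 0 ≤ t → t < τ → NoUnitEigenvalue (limKernel θ) t :=
  exists_noUnitEigenvalue_of_continuous (Suzuki2020_thm12_continuous hθ)

end Literature.NumberTheory.LFunctions

end
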